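import Summits.BirchSwinnertonDyer.BirchSwinnertonDyer.Theorems.KolyvaginDepthDoorMSymbolCertUnique
import HarnessLib

/-!
# Route `KolyvaginDepthDoor`, crux `KolyvaginDepthSupplyKN` (stmt-BirchSwinnertonDyer-22820) —
# DEPTH TABLE v27, KIT 2b/4: the uniqueness certificate with RANDOM-ACCESS tables (kernel-efficient form)

Helper file of the lead prover of line `levelone` (kdd-p1 g31; `--supports stmt-BirchSwinnertonDyer-22820
--as helper`); it closes nothing and BSD is NOT proved by it. Pure linear algebra.

The certificate `Cert` of `…MSymbolCertUnique` stores the expression vectors `E_j` and the inverse `B` as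
lists of lists, so the kernel pays a linear scan per access and recomputes the core matrix `A'` inside the
product `A'B` (cubic recomputation). `CertF` below is the SAME certificate with the three tables given as
functions `ℕ → ℕ → ℤ` (instantiated by digit extraction from one packed numeral: constant-time access for the
kernel's GMP arithmetic) and with the core matrix `A'` supplied as DATA (`aTab`) that the checker VERIFIES
against the equations once (`aTab r t = comb (gen e_r) (t+1)`) before using it in `A'B ≡ 1 (mod q)`. The
soundness theorem `exists_eq_smul_of_checkF` is the one of kit 2, with the same proof.

References: [CremonaAlgorithms1997] §2.2–2.5.
-/

set_option linter.dupNamespace false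

namespace Summit.BirchSwinnertonDyer.BirchSwinnertonDyer.Theorems.KolyvaginDepthDoor.MSymbolCert

/-- A uniqueness certificate with random-access tables (see `Cert` and the module docstring). [folklore] -/
structure CertF where
  /-- number of core unknowns -/
  m : ℕ
  /-- the core indices `c₀, …, c_{m-1}` (`c₀` the pivot) -/
  core : List ℕ
  /-- expression table: `ex j k = E_j[k]` -/
  ex : ℕ → ℕ → ℤ
  /-- peeling steps `(equation code, new unknown)` -/
  steps : List (ℕ × ℕ)
  /-- the `m - 1` core equation codes -/
  coreEqs : List ℕ
  /-- modulus of the rank certificate -/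
  q : ℕ
  /-- the core matrix `A'`: `aTab r t` = core equation `r` in core coordinates, column `t + 1` -/
  aTab : ℕ → ℕ → ℤ
  /-- `(m-1) × (m-1)` matrix with `A' · B ≡ 1 (mod q)`: `bTab t s` -/
  bTab : ℕ → ℕ → ℤ

namespace CertF

variable (C : CertF)

/-- `c_k`. [folklore] -/
def cr (k : ℕ) : ℕ := C.core.getD k 0

/-- `∑_{(j,c) ∈ L} c · E_j[k]`. [folklore] -/
def comb (L : Eqn) (k : ℕ) : ℤ := match L with
  | [] => 0
  | (j, c) :: L => c * C.ex j k + comb L k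

/-- One peeling step is valid (as in `Cert.stepOK`). [folklore] -/
def stepOK (known : List ℕ) (e : Eqn) (j : ℕ) : Bool :=
  (coefAt e j == 1 || coefAt e j == -1) &&
    (rest e j).all (fun jc => decide (jc.1 ∈ known)) &&
    (List.range C.m).all (fun k => C.ex j k == -(coefAt e j) * C.comb (rest e j) k)

/-- Peeling (as in `Cert.peel`). [folklore] -/
def peel (gen : ℕ → Eqn) : List ℕ → List (ℕ × ℕ) → Option (List ℕ)
  | known, [] => some known
  | known, (code, j) :: steps =>
    if C.stepOK known (gen code) j then peel gen (j :: known) steps else none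

/-- `(A' B)_{r s}` from the tables. [folklore] -/
def abEntry (r s : ℕ) : ℤ :=
  ((List.range (C.m - 1)).map fun t => C.aTab r t * C.bTab t s).sum

/-- The full check (as `Cert.check`, plus the verification of the supplied core matrix `aTab`). [folklore] -/
def checkF (gen : ℕ → Eqn) (K X : ℕ) (φ : ℕ → ℤ) : Bool :=
  decide (0 < C.m) && decide (1 < C.q) && decide (C.coreEqs.length = C.m - 1) &&
  decide (C.core.length = C.m) &&
  (List.range C.m).all (fun k => (List.range C.m).all fun k' =>
    C.ex (C.cr k) k' == if k = k' then 1 else 0) &&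
  C.steps.all (fun s => decide (s.1 < K)) && C.coreEqs.all (fun k => decide (k < K)) &&
  (match C.peel gen C.core C.steps with
    | none => false
    | some known => (List.range X).all (fun i => decide (i ∈ known)) &&
        C.coreEqs.all (fun k => (gen k).all fun jc => decide (jc.1 ∈ known))) &&
  -- the supplied core matrix is correct
  (List.range (C.m - 1)).all (fun r => (List.range (C.m - 1)).all fun t =>
    C.aTab r t == C.comb (gen (C.coreEqs.getD r 0)) (t + 1)) &&
  (List.range (C.m - 1)).all (fun r => (List.range (C.m - 1)).all fun s =>
    C.abEntry r s % (C.q : ℤ) == if r = s then 1 else 0) &&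
  (List.range K).all (fun k => evalInt φ (gen k) == 0) && (φ (C.cr 0) != 0)

end CertF

section SoundF

variable (C : CertF) (gen : ℕ → Eqn)

/-- `∑_{k<m} E_j[k] · F(c_k)`. [folklore] -/
def exprSumF (F : ℕ → ℝ) (j : ℕ) : ℝ := ∑ k ∈ Finset.range C.m, (C.ex j k : ℝ) * F (C.cr k)

/-- A sparse form all of whose unknowns are expressed evaluates through `comb`. [folklore] -/
theorem eval_eq_sum_combF (F : ℕ → ℝ) (L : Eqn) (hL : ∀ jc ∈ L, F jc.1 = exprSumF C F jc.1) :
    eval F L = ∑ k ∈ Finset.range C.m, (C.comb L k : ℝ) * F (C.cr k) := by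
  induction L with
  | nil => simp [eval, CertF.comb]
  | cons jc L ih =>
    obtain ⟨j, c⟩ := jc
    have hj : F j = exprSumF C F j := hL (j, c) (by simp)
    have ih' := ih (fun jc hjc => hL jc (by simp [hjc]))
    simp only [eval, CertF.comb, Int.cast_add, Int.cast_mul]
    rw [ih', hj, exprSumF, Finset.mul_sum, ← Finset.sum_add_distrib]
    refine Finset.sum_congr rfl fun k _ => ?_
    ring

/-- Soundness of one peeling step. [folklore] -/
theorem expressed_of_stepOKF (F : ℕ → ℝ) (known : List ℕ) (e : Eqn) (j : ℕ)
    (hstep : C.stepOK known e j = true) (hknown : ∀ j' ∈ known, F j' = exprSumF C F j')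
    (he : eval F e = 0) : F j = exprSumF C F j := by
  simp only [CertF.stepOK, Bool.and_eq_true, Bool.or_eq_true, beq_iff_eq, List.all_eq_true,
    decide_eq_true_eq, List.mem_range] at hstep
  obtain ⟨⟨hc, hrest⟩, hex⟩ := hstep
  have hsplit := eval_eq_coefAt_add F e j
  have hrest' : ∀ jc ∈ rest e j, F jc.1 = exprSumF C F jc.1 := fun jc hjc => hknown _ (hrest jc hjc)
  rw [he, eval_eq_sum_combF C F _ hrest'] at hsplit
  have hcu : (coefAt e j : ℝ) * (coefAt e j : ℝ) = 1 := by
    rcases hc with h | h <;> simp [h]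
  have hFj : F j = -(coefAt e j : ℝ) * ∑ k ∈ Finset.range C.m, (C.comb (rest e j) k : ℝ) * F (C.cr k) := by
    have := congrArg (fun x => (coefAt e j : ℝ) * x) hsplit
    simp only [mul_zero, mul_add, ← mul_assoc, hcu, one_mul] at this
    linarith
  rw [exprSumF, hFj, Finset.mul_sum]
  refine Finset.sum_congr rfl fun k hk => ?_
  rw [hex k (Finset.mem_range.mp hk)]
  push_cast
  ring

/-- Soundness of peeling. [folklore] -/
theorem expressed_of_peelF (F : ℕ → ℝ) (K : ℕ) (hF : ∀ k < K, eval F (gen k) = 0) :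
    ∀ (steps : List (ℕ × ℕ)) (known final : List ℕ), (∀ s ∈ steps, s.1 < K) →
      C.peel gen known steps = some final → (∀ j ∈ known, F j = exprSumF C F j) →
      ∀ j ∈ final, F j = exprSumF C F j := by
  intro steps
  induction steps with
  | nil =>
    intro known final _ h hknown
    simp only [CertF.peel, Option.some.injEq] at h
    subst h
    exact hknown
  | cons s steps ih =>
    intro known final hK h hknown
    obtain ⟨code, j⟩ := s
    simp only [CertF.peel] at h
    split_ifs at h with hstep
    have hj : F j = exprSumF C F j :=
      expressed_of_stepOKF C F known (gen code) j hstep hknown (hF code (hK (code, j) (by simp)))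
    refine ih (j :: known) final (fun s hs => hK s (by simp [hs])) h ?_
    intro j' hj'
    rcases List.mem_cons.mp hj' with rfl | hj'
    · exact hj
    · exact hknown j' hj'

/-- **Soundness of the random-access certificate.** If `checkF gen K X φ C = true` then every real solution
of the pool `gen 0, …, gen (K-1)` is a real multiple of `φ` on `{0, …, X-1}`. [cite: CremonaAlgorithms1997, §2.5] -/
theorem exists_eq_smul_of_checkF (K X : ℕ) (φ : ℕ → ℤ) (hcheck : C.checkF gen K X φ = true)
    (F : ℕ → ℝ) (hF : ∀ k < K, eval F (gen k) = 0) :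
    ∃ t : ℝ, ∀ i < X, F i = t * φ i := by
  simp only [CertF.checkF, Bool.and_eq_true, decide_eq_true_eq, List.all_eq_true, List.mem_range,
    beq_iff_eq, bne_iff_ne, ne_eq] at hcheck
  obtain ⟨⟨⟨⟨⟨⟨⟨⟨⟨⟨⟨hm, hq⟩, hlen⟩, hcorelen⟩, hunit⟩, hstepsK⟩, hcoreK⟩, hpeel⟩, haTab⟩, hmat⟩, hφ⟩,
    hφ0⟩ := hcheck
  cases hp : C.peel gen C.core C.steps with
  | none => simp [hp] at hpeel
  | some final =>
    simp only [hp, Bool.and_eq_true, List.all_eq_true, List.mem_range, decide_eq_true_eq] at hpeel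
    obtain ⟨hcover, hcoreKnown⟩ := hpeel
    set t : ℝ := F (C.cr 0) / (φ (C.cr 0) : ℝ) with ht
    set G : ℕ → ℝ := fun i => F i - t * (φ i : ℝ) with hG
    have hφR : ∀ k < K, eval (fun j => (φ j : ℝ)) (gen k) = 0 := fun k hk => by
      rw [eval_intCast, hφ k hk]; simp
    have hGsol : ∀ k < K, eval G (gen k) = 0 := fun k hk => by
      rw [hG, eval_sub_smul, hF k hk, hφR k hk]; simp
    have hG0 : G (C.cr 0) = 0 := by
      have hφ0' : (φ (C.cr 0) : ℝ) ≠ 0 := by exact_mod_cast hφ0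
      simp only [hG, ht]
      field_simp
      ring
    have hcoreExpr : ∀ j ∈ C.core, G j = exprSumF C G j := by
      intro j hj
      obtain ⟨k, hk, rfl⟩ := List.getElem_of_mem hj
      have hk' : C.cr k = C.core[k] := by simp [CertF.cr, List.getD_eq_getElem?_getD, hk]
      rw [exprSumF, ← hk', Finset.sum_eq_single k]
      · rw [hunit k (by omega) k (by omega)]; simp
      · intro k' hk'm hne
        rw [hunit k (by omega) k' (Finset.mem_range.mp hk'm), if_neg (Ne.symm hne)]; simp
      · intro hk; exact absurd (Finset.mem_range.mpr (by omega)) hk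
    have hall : ∀ j ∈ final, G j = exprSumF C G j :=
      expressed_of_peelF C gen G K hGsol C.steps C.core final hstepsK hp hcoreExpr
    set n := C.m - 1 with hn
    let A : Matrix (Fin n) (Fin n) ℤ := fun r s => C.aTab r s
    let y : Fin n → ℝ := fun s => G (C.cr (s + 1))
    have hAy : (A.map (Int.castRingHom ℝ)).mulVec y = 0 := by
      ext r
      simp only [Matrix.mulVec, dotProduct, Matrix.map_apply, eq_intCast, Pi.zero_apply]
      have hr : (r : ℕ) < C.coreEqs.length := by rw [hlen]; exact r.2
      have hcode : C.coreEqs.getD r 0 = C.coreEqs[(r : ℕ)] := by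
        simp [List.getD_eq_getElem?_getD, hr]
      have hmem : C.coreEqs[(r : ℕ)] ∈ C.coreEqs := List.getElem_mem hr
      have hsol := hGsol (C.coreEqs.getD r 0) (by rw [hcode]; exact hcoreK _ hmem)
      have hexpr : ∀ jc ∈ gen (C.coreEqs.getD r 0), G jc.1 = exprSumF C G jc.1 := fun jc hjc =>
        hall _ (hcoreKnown _ (by rw [hcode]; exact hmem) jc hjc)
      rw [eval_eq_sum_combF C G _ hexpr] at hsol
      rw [show C.m = n + 1 by omega, Finset.sum_range_succ'] at hsol
      rw [hG0, mul_zero, add_zero] at hsol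
      rw [← hsol, Finset.sum_range (fun i => (C.comb (gen (C.coreEqs.getD r 0)) (i + 1) : ℝ) * G (C.cr (i + 1)))]
      refine Finset.sum_congr rfl fun i _ => ?_
      simp only [A, y, haTab r r.2 i i.2]
    haveI : Fact (1 < C.q) := ⟨hq⟩
    have hdet : A.det ≠ 0 := by
      intro h0
      let Aq : Matrix (Fin n) (Fin n) (ZMod C.q) := A.map (Int.castRingHom (ZMod C.q))
      let Bq : Matrix (Fin n) (Fin n) (ZMod C.q) := fun t s => ((C.bTab t s : ℤ) : ZMod C.q)
      have hAB : Aq * Bq = 1 := by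
        ext r s
        have h := hmat r r.2 s s.2
        have hsum : C.abEntry r s = ∑ t : Fin n, A r t * C.bTab t s := by
          rw [CertF.abEntry, list_range_map_sum, ← Fin.sum_univ_eq_sum_range]
        have hcast : ((C.abEntry r s : ℤ) : ZMod C.q) = if (r : ℕ) = s then 1 else 0 := by
          rw [← ZMod.intCast_mod, h]
          split_ifs <;> simp
        have e1 : (Aq * Bq) r s = ((∑ t : Fin n, A r t * C.bTab t s : ℤ) : ZMod C.q) := by
          rw [Matrix.mul_apply]
          push_cast
          simp only [Aq, Bq, Matrix.map_apply, eq_intCast]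
        rw [e1, ← hsum, hcast, Matrix.one_apply]
        by_cases hrs : r = s
        · simp [hrs]
        · simp [hrs, Fin.val_inj.not.mpr hrs]
      have hu : IsUnit Aq.det := Matrix.isUnit_det_of_right_inverse hAB
      have hdq : Aq.det = ((A.det : ℤ) : ZMod C.q) := by
        simp only [Aq]
        rw [← RingHom.mapMatrix_apply, ← RingHom.map_det]; simp
      rw [hdq, h0, Int.cast_zero] at hu
      exact not_isUnit_zero hu
    have hdetR : (A.map (Int.castRingHom ℝ)).det ≠ 0 := by
      rw [← RingHom.mapMatrix_apply, ← RingHom.map_det]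
      simpa using hdet
    have hy : y = 0 := Matrix.eq_zero_of_mulVec_eq_zero hdetR hAy
    have hcore0 : ∀ k < C.m, G (C.cr k) = 0 := by
      intro k hk
      rcases k with _ | k
      · exact hG0
      · have := congrFun hy ⟨k, by omega⟩
        simpa [y] using this
    refine ⟨t, fun i hi => ?_⟩
    have hGi : G i = 0 := by
      rw [hall i (hcover i hi), exprSumF]
      exact Finset.sum_eq_zero fun k hk => by rw [hcore0 k (Finset.mem_range.mp hk), mul_zero]
    have : F i - t * (φ i : ℝ) = 0 := hGi
    linarith

end SoundF

/-! ## Packed tables: digit extraction -/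

/-- Digit `i` of `Φ` in base `2^w`, shifted by `off`: the packed-table accessor (`(Φ / 2^{w i}) mod 2^w - off`).
Constant-time for the kernel's arbitrary-precision arithmetic. [folklore] -/
def digitAt (Φ w off i : ℕ) : ℤ := ((Φ / 2 ^ (w * i) % 2 ^ w : ℕ) : ℤ) - off

end Summit.BirchSwinnertonDyer.BirchSwinnertonDyer.Theorems.KolyvaginDepthDoor.MSymbolCert
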